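import Summits.QuantumFields.BalabanUV.T4Continuum.Spine.NE9.SummableMemory

/-!
# T⁴ programme, spine estimate NE9 (node U3, history side) — ROW sums versus COLUMN sums of the history moduli:
# what each ℓ¹ (Schur) currency of the E-side memory buys at nodes U5b ∕ U3 → U6, and the verdict on «NE9′ = NE9 with
# `FadingMemory` weakened to K-uniform ROW sums» — census item of cell `pub-balaban-gaps`, seat ne9 (gen 3)

Cell `pub-balaban-gaps` (YM blitz G2, seat ne9, unit `pub-balaban-gaps-ne9-g3`; record `run/shared/lean/pub/pub-balaban-gaps/ne/NE9.md`
§5 rows C20 ∕ C21).  Summits-side bookkeeping over the Literature SHAPES `T4OutputRate.NE9` ∕ `T4OutputRate.FadingMemory` and node U6's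
`T4CauchySum.delta`; the seat's previous census file `Spine/NE9/SummableMemory` (gen 2, age profiles) is imported and its node-U6 lemma
`summable_delta_of_scaleProfile` is used BY NAME; nothing of the row's `Support/NE9*` modules is imported or edited.

WHY.  The β-side station (E33) of the b2b cell (`Beta/EriceRemainderEnclosureHistoryRenewal{,Rate,Uniform,…}`) replaced node U2's
`T4CouplingMatching.FadingMemory` of the β-HISTORY moduli by the K-uniform ROW total weight `Σ_{i≤k} Λ k i ≤ M` (plus a sign ∕ floor and the
smallness `M·U < 1`), and the NE4 seat of this cell booked the consequence «NE9′ = NE9 with `T4OutputRate.FadingMemory` weakened to K-uniform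
row sums» ([NE4-G2-ROW v2.3] (R28)).  On the E-side the history moduli `Λ j i` of `T4OutputRate.NE9` are a (lower-triangular) KERNEL acting on
the coupling discrepancies `|g^A_i − g^B_i|`, and the two ℓ¹ (Schur) norms of that kernel buy DIFFERENT things:
* ROW sums `sup_k Σ_{i≤k} Λ k i ≤ M` (the ℓ^∞ → ℓ^∞ norm) buy node U5b's structural claim and nothing more: under a UNIFORM discrepancy
  `|g^A_i − g^B_i| ≤ D` the coupling bracket of `T4OutputRate.u3_threeBrackets` is `≤ M·D` uniformly in the creation step
  (`historySum_le_of_rowSum`, generalising `T4OutputRate.historySum_le_of_fadingMemory` and `SummableMemory.historySum_le_tsum_mul`);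
* COLUMN sums `sup_i Σ_{k>i} Λ k i ≤ M_c` (the ℓ¹ → ℓ¹ norm: the TOTAL influence of one coupling `g_i` on ALL later terms) buy node U6:
  against a SUMMABLE discrepancy profile `d` the bracket majorant `j ↦ Σ_{i<j} Λ j i·d_i` has partial sums `≤ M_c·Σ_i d_i` (finite Fubini,
  `sum_historySum_le_of_colSum`), hence is ℓ¹ over the creation steps (`summable_historySum_of_colSum`, `tsum_historySum_le_of_colSum`), is
  a fortiori creation-step-uniform (`historySum_le_of_colSum` — the column currency ALSO serves U5b once the discrepancies are ℓ¹), and feeds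
  node U6's socket `Summable (T4CauchySum.delta E ρ inj)` for every injection it dominates (`summable_delta_of_colSum`;
  `ne9_bracket_of_colSum` is the end-to-end statement at node U3);
* `FadingMemory C₉ ω` and every summable age profile `λ(k − i)` have BOTH norms finite (`rowSum_le_of_fadingMemory`,
  `colSum_le_of_fadingMemory` with `C₉(1−ω)⁻¹`; `rowSum_le_of_ageProfile`, `colSum_le_of_ageProfile` with `Σ_n λ(n)`), which is why the
  distinction was invisible in the record and in gen 2's file;
* ROWS ALONE DO NOT REACH NODE U6 (`exists_rowBounded_bracket_not_summable`): the «bare-coupling memory» `Λ♭ k i = 𝟙_{i=0}` (every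
  term remembers only `g₀`, with weight one) has all row sums `= 1`, is NOT `FadingMemory C ω` for any `ω < 1`, has UNBOUNDED column `0`,
  and against the geometrically small, summable discrepancy `d = 𝟙_{i=0} ≤ (½)^i` its bracket is `≡ 1` from step 1 on — not summable,
  not even tending to `0`.  So the E-side reading of (R28) is: the weakening of `T4OutputRate.FadingMemory` that node U3 → U6 tolerates is
  BOUNDED COLUMN SUMS (with ℓ¹ coupling discrepancies from node U2), not bounded row sums; bounded rows are what node U2's β-side row split
  and a linear read-out of β from E consume.  Where the moduli come from — Bałaban's one-step recursion — both norms are finite exactly under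
  the record's smallness clause N2 (the companion file `Spine/NE9/SchurRenewal` states N2 intrinsically as the Schur norm `< 1` of the
  old-term channel); for the classification of NE9 this file is NEUTRAL (WORK-bound on the one-step model W1, unchanged).

WHAT IS PROVED (kernel; elementary real analysis, `[folklore]`): §1 `rowSum_le_of_fadingMemory`, `colSum_le_of_fadingMemory`,
`rowSum_le_of_ageProfile`, `colSum_le_of_ageProfile`; §2 `historySum_le_of_rowSum`, `ne9_uniform_of_rowSum`; §3 `sum_historySum_le_of_colSum`,
`summable_historySum_of_colSum`, `tsum_historySum_le_of_colSum`, `historySum_le_of_colSum`, `ne9_bracket_of_colSum`, `summable_delta_of_colSum`;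
§4 `bareMemory_rowSum`, `bareMemory_not_fadingMemory`, `bareMemory_colSum`, `bareMemory_bracket`, `exists_rowBounded_bracket_not_summable`.

HONEST FRAMING: bookkeeping for rung (B)+1 on a FIXED finite four-torus; facts about the SHAPE of NE9 and the socket of node U6, not about
Bałaban's functionals; NE9 is NOT PRINTED ([Balaban1987RG1] p. 263 gives only *"It is a C^∞-function of g_{j−1} ∈ [0, γ], (or analytic)"*
and p. 256 ∕ p. 298 the existence of the dependence on all preceding couplings) and NOT PROVED; spine PROVED 0∕9 unchanged; NOT UV
stability, NOT the continuum limit, NOT infinite volume, NOT a mass gap, NOT Clay.  HONEST DEPENDENCY: continuum YM on T⁴ ⇐ BetaPertH ∧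
nine spine estimates (0∕9 proved); BetaPertH ⇐ (D1) ∧ (D4) ∧ CAP+tail.

References (TYPES only): [Balaban1987RG1] = T. Bałaban, Commun. Math. Phys. **109** (1987) 249–301, p. 256, p. 263, p. 298.
-/

namespace Summit.QuantumFields.BalabanUV.T4Continuum.NE9.SchurMemory

open scoped BigOperators
open Finset Filter Topology
open Literature.MathematicalPhysics.QuantumFieldTheory.Balaban1983to89
open Literature.MathematicalPhysics.QuantumFieldTheory.Balaban1983to89.T4OutputRate
open T4CauchySum (delta)
open Summit.QuantumFields.BalabanUV.T4Continuum.NE9.SummableMemory (summable_delta_of_scaleProfile)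

variable {C : Carriers} {Bg : Type}

/-! ## §1 Both Schur norms of the spine's shapes are finite -/

/-- `FadingMemory C₉ ω Λ` (`0 ≤ ω < 1`) has ROW sums `Σ_{i≤k} Λ k i ≤ C₉(1−ω)⁻¹`, uniformly in the row `k`. [folklore] -/
theorem rowSum_le_of_fadingMemory {C₉ ω : ℝ} {Λ : ℕ → ℕ → ℝ} (hΛ : FadingMemory C₉ ω Λ)
    (hω0 : 0 ≤ ω) (hω1 : ω < 1) (k : ℕ) :
    ∑ i ∈ range (k + 1), Λ k i ≤ C₉ * (1 - ω)⁻¹ := by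
  have hC9 : 0 ≤ C₉ := by
    have h00 := hΛ 0 0 le_rfl
    simpa using h00.1.trans h00.2
  have hgeom : HasSum (fun n : ℕ => ω ^ n) (1 - ω)⁻¹ := hasSum_geometric_of_lt_one hω0 hω1
  have hrefl : ∑ i ∈ range (k + 1), ω ^ (k - i) = ∑ m ∈ range (k + 1), ω ^ m := sum_flip (fun m => ω ^ m)
  calc ∑ i ∈ range (k + 1), Λ k i ≤ ∑ i ∈ range (k + 1), C₉ * ω ^ (k - i) :=
        sum_le_sum fun i hi => (hΛ k i (Nat.lt_succ_iff.mp (mem_range.mp hi))).2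
    _ = C₉ * ∑ m ∈ range (k + 1), ω ^ m := by rw [← mul_sum, hrefl]
    _ ≤ C₉ * (1 - ω)⁻¹ :=
        mul_le_mul_of_nonneg_left (sum_le_hasSum _ (fun n _ => pow_nonneg hω0 n) hgeom) hC9

/-- `FadingMemory C₉ ω Λ` (`0 ≤ ω < 1`) has COLUMN sums `Σ_{k ∈ [i, N)} Λ k i ≤ C₉(1−ω)⁻¹`, uniformly in the column `i` and the
cutoff `N`. [folklore] -/
theorem colSum_le_of_fadingMemory {C₉ ω : ℝ} {Λ : ℕ → ℕ → ℝ} (hΛ : FadingMemory C₉ ω Λ)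
    (hω0 : 0 ≤ ω) (hω1 : ω < 1) (i N : ℕ) :
    ∑ k ∈ Ico i N, Λ k i ≤ C₉ * (1 - ω)⁻¹ := by
  have hC9 : 0 ≤ C₉ := by
    have h00 := hΛ 0 0 le_rfl
    simpa using h00.1.trans h00.2
  have hgeom : HasSum (fun n : ℕ => ω ^ n) (1 - ω)⁻¹ := hasSum_geometric_of_lt_one hω0 hω1
  calc ∑ k ∈ Ico i N, Λ k i ≤ ∑ k ∈ Ico i N, C₉ * ω ^ (k - i) :=
        sum_le_sum fun k hk => (hΛ k i (mem_Ico.mp hk).1).2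
    _ = C₉ * ∑ m ∈ range (N - i), ω ^ m := by
        rw [← mul_sum, sum_Ico_eq_sum_range]
        congr 1
        exact sum_congr rfl fun m _ => by rw [Nat.add_sub_cancel_left]
    _ ≤ C₉ * (1 - ω)⁻¹ :=
        mul_le_mul_of_nonneg_left (sum_le_hasSum _ (fun n _ => pow_nonneg hω0 n) hgeom) hC9

/-- A nonnegative summable AGE PROFILE `0 ≤ Λ k i ≤ λ(k − i)` has ROW sums `≤ Σ_n λ(n)`. [folklore] -/
theorem rowSum_le_of_ageProfile {lam : ℕ → ℝ} {Λ : ℕ → ℕ → ℝ}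
    (hΛ : ∀ k i, i ≤ k → 0 ≤ Λ k i ∧ Λ k i ≤ lam (k - i)) (hlam0 : ∀ n, 0 ≤ lam n) (hlam : Summable lam) (k : ℕ) :
    ∑ i ∈ range (k + 1), Λ k i ≤ ∑' n, lam n := by
  have hrefl : ∑ i ∈ range (k + 1), lam (k - i) = ∑ m ∈ range (k + 1), lam m := sum_flip lam
  calc ∑ i ∈ range (k + 1), Λ k i ≤ ∑ i ∈ range (k + 1), lam (k - i) :=
        sum_le_sum fun i hi => (hΛ k i (Nat.lt_succ_iff.mp (mem_range.mp hi))).2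
    _ = ∑ m ∈ range (k + 1), lam m := hrefl
    _ ≤ ∑' n, lam n := sum_le_hasSum _ (fun n _ => hlam0 n) hlam.hasSum

/-- A nonnegative summable AGE PROFILE `0 ≤ Λ k i ≤ λ(k − i)` has COLUMN sums `≤ Σ_n λ(n)`. [folklore] -/
theorem colSum_le_of_ageProfile {lam : ℕ → ℝ} {Λ : ℕ → ℕ → ℝ}
    (hΛ : ∀ k i, i ≤ k → 0 ≤ Λ k i ∧ Λ k i ≤ lam (k - i)) (hlam0 : ∀ n, 0 ≤ lam n) (hlam : Summable lam) (i N : ℕ) :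
    ∑ k ∈ Ico i N, Λ k i ≤ ∑' n, lam n := by
  calc ∑ k ∈ Ico i N, Λ k i ≤ ∑ k ∈ Ico i N, lam (k - i) :=
        sum_le_sum fun k hk => (hΛ k i (mem_Ico.mp hk).1).2
    _ = ∑ m ∈ range (N - i), lam m := by
        rw [sum_Ico_eq_sum_range]
        exact sum_congr rfl fun m _ => by rw [Nat.add_sub_cancel_left]
    _ ≤ ∑' n, lam n := sum_le_hasSum _ (fun n _ => hlam0 n) hlam.hasSum

/-! ## §2 What ROW sums buy: node U5b's creation-step-uniform bracket (and only that) -/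

/-- **ROWS ⇒ U5b.**  Nonnegative moduli with ROW sums `≤ M` (the hypothesis shape of the b2b station (E33),
`∀ k, Σ_{i ∈ range (k+1)} Λ k i ≤ M`) and a UNIFORM coupling discrepancy `|g^A_i − g^B_i| ≤ D` give the coupling bracket of node U3
`≤ M·D` at EVERY creation step — `T4OutputRate.historySum_le_of_fadingMemory` (`M = C₉(1−ω)⁻¹`) and
`SummableMemory.historySum_le_tsum_mul` (`M = Σλ`) are the two instances of §1. [folklore] -/
theorem historySum_le_of_rowSum {Λ : ℕ → ℕ → ℝ} {M : ℝ} (hΛ : ∀ k i, i ≤ k → 0 ≤ Λ k i)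
    (hrow : ∀ k, ∑ i ∈ range (k + 1), Λ k i ≤ M)
    {gA gB : ℕ → ℝ} {D : ℝ} (hD : ∀ i, |gA i - gB i| ≤ D) (j : ℕ) :
    ∑ i ∈ range j, Λ j i * |gA i - gB i| ≤ M * D := by
  have hD0 : 0 ≤ D := (abs_nonneg _).trans (hD 0)
  calc ∑ i ∈ range j, Λ j i * |gA i - gB i| ≤ ∑ i ∈ range j, Λ j i * D :=
        sum_le_sum fun i hi => mul_le_mul_of_nonneg_left (hD i) (hΛ j i (mem_range.mp hi).le)
    _ = (∑ i ∈ range j, Λ j i) * D := by rw [sum_mul]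
    _ ≤ (∑ i ∈ range (j + 1), Λ j i) * D := by
        refine mul_le_mul_of_nonneg_right ?_ hD0
        exact sum_le_sum_of_subset_of_nonneg (range_mono (Nat.le_succ j))
          fun i hi _ => hΛ j i (Nat.lt_succ_iff.mp (mem_range.mp hi))
    _ ≤ M * D := mul_le_mul_of_nonneg_right (hrow j) hD0

/-- **NE9′ OF (R28), END TO END AT NODE U3**: `NE9 E W κ Λ` with nonnegative ROW-bounded moduli and a uniform coupling discrepancy `D`
give `|E g^A U X − E g^B U X| ≤ e^{−κd(X)}·M·D` at every scale — the influence of the history does not accumulate (node U5b).  What it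
does NOT give is any decay in the creation step (§4). [folklore] -/
theorem ne9_uniform_of_rowSum {E : Functional C Bg} {W : Set (ℕ → ℝ)} {κ M : ℝ} {Λ : ℕ → ℕ → ℝ}
    (h9 : NE9 E W κ Λ) (hΛ : ∀ k i, i ≤ k → 0 ≤ Λ k i) (hrow : ∀ k, ∑ i ∈ range (k + 1), Λ k i ≤ M)
    {gA gB : ℕ → ℝ} (hgA : gA ∈ W) (hgB : gB ∈ W) {D : ℝ} (hD : ∀ i, |gA i - gB i| ≤ D) (U : Bg) (X : C.Dom) :
    |E gA U X - E gB U X| ≤ Real.exp (-(κ * C.d X)) * (M * D) :=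
  (h9 gA hgA gB hgB U X).trans
    (mul_le_mul_of_nonneg_left (historySum_le_of_rowSum hΛ hrow hD _) (Real.exp_pos _).le)

/-! ## §3 What COLUMN sums buy: an ℓ¹ bracket, hence node U6 -/

/-- **FINITE FUBINI FOR THE BRACKET.**  Nonnegative moduli with COLUMN sums `Σ_{k ∈ (i, N)} Λ k i ≤ M_c` (all `i`, `N`) and a nonnegative
discrepancy profile `d`: the partial sums of the bracket majorant obey `Σ_{j<N} Σ_{i<j} Λ j i·d_i ≤ M_c·Σ_{i<N} d_i`. [folklore] -/
theorem sum_historySum_le_of_colSum {Λ : ℕ → ℕ → ℝ} {Mc : ℝ} (hcol : ∀ i N, ∑ k ∈ Ico (i + 1) N, Λ k i ≤ Mc)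
    {d : ℕ → ℝ} (hd0 : ∀ i, 0 ≤ d i) (N : ℕ) :
    ∑ j ∈ range N, ∑ i ∈ range j, Λ j i * d i ≤ Mc * ∑ i ∈ range N, d i := by
  have hswap : ∑ j ∈ range N, ∑ i ∈ range j, Λ j i * d i =
      ∑ i ∈ range N, ∑ j ∈ Ico (i + 1) N, Λ j i * d i := by
    refine sum_comm' fun j i => ?_
    simp only [mem_range, mem_Ico]
    omega
  rw [hswap, mul_sum]
  refine sum_le_sum fun i _ => ?_
  rw [← sum_mul]
  exact mul_le_mul_of_nonneg_right (hcol i N) (hd0 i)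

/-- **COLUMNS ⇒ THE BRACKET MAJORANT IS ℓ¹.**  Nonnegative column-bounded moduli against a nonnegative SUMMABLE discrepancy profile: the
bracket majorant `j ↦ Σ_{i<j} Λ j i·d_i` is summable over the creation steps. [folklore] -/
theorem summable_historySum_of_colSum {Λ : ℕ → ℕ → ℝ} {Mc : ℝ} (hΛ : ∀ k i, i ≤ k → 0 ≤ Λ k i)
    (hcol : ∀ i N, ∑ k ∈ Ico (i + 1) N, Λ k i ≤ Mc)
    {d : ℕ → ℝ} (hd0 : ∀ i, 0 ≤ d i) (hd : Summable d) :
    Summable (fun j => ∑ i ∈ range j, Λ j i * d i) := by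
  have hMc : 0 ≤ Mc := by simpa using hcol 0 1
  refine summable_of_sum_range_le (c := Mc * ∑' i, d i)
    (fun j => sum_nonneg fun i hi => mul_nonneg (hΛ j i (mem_range.mp hi).le) (hd0 i)) fun N => ?_
  exact (sum_historySum_le_of_colSum hcol hd0 N).trans
    (mul_le_mul_of_nonneg_left (sum_le_hasSum _ (fun i _ => hd0 i) hd.hasSum) hMc)

/-- … with total `Σ_j Σ_{i<j} Λ j i·d_i ≤ M_c·Σ_i d_i`. [folklore] -/
theorem tsum_historySum_le_of_colSum {Λ : ℕ → ℕ → ℝ} {Mc : ℝ} (hΛ : ∀ k i, i ≤ k → 0 ≤ Λ k i)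
    (hcol : ∀ i N, ∑ k ∈ Ico (i + 1) N, Λ k i ≤ Mc)
    {d : ℕ → ℝ} (hd0 : ∀ i, 0 ≤ d i) (hd : Summable d) :
    ∑' j, ∑ i ∈ range j, Λ j i * d i ≤ Mc * ∑' i, d i := by
  have hMc : 0 ≤ Mc := by simpa using hcol 0 1
  refine Real.tsum_le_of_sum_range_le
    (fun j => sum_nonneg fun i hi => mul_nonneg (hΛ j i (mem_range.mp hi).le) (hd0 i)) fun N => ?_
  exact (sum_historySum_le_of_colSum hcol hd0 N).trans
    (mul_le_mul_of_nonneg_left (sum_le_hasSum _ (fun i _ => hd0 i) hd.hasSum) hMc)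

/-- **COLUMNS ALSO SERVE U5b** once the discrepancies are ℓ¹: a single bracket is below the total, `Σ_{i<j} Λ j i·d_i ≤ M_c·Σ_i d_i`,
uniformly in the creation step `j`. [folklore] -/
theorem historySum_le_of_colSum {Λ : ℕ → ℕ → ℝ} {Mc : ℝ} (hΛ : ∀ k i, i ≤ k → 0 ≤ Λ k i)
    (hcol : ∀ i N, ∑ k ∈ Ico (i + 1) N, Λ k i ≤ Mc)
    {d : ℕ → ℝ} (hd0 : ∀ i, 0 ≤ d i) (hd : Summable d) (j : ℕ) :
    ∑ i ∈ range j, Λ j i * d i ≤ Mc * ∑' i, d i := by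
  have hMc : 0 ≤ Mc := by simpa using hcol 0 1
  have h1 : ∑ i ∈ range j, Λ j i * d i ≤ ∑ j' ∈ range (j + 1), ∑ i ∈ range j', Λ j' i * d i :=
    single_le_sum (f := fun j' => ∑ i ∈ range j', Λ j' i * d i)
      (fun j' _ => sum_nonneg fun i hi => mul_nonneg (hΛ j' i (mem_range.mp hi).le) (hd0 i)) (self_mem_range_succ j)
  exact h1.trans ((sum_historySum_le_of_colSum hcol hd0 (j + 1)).trans
    (mul_le_mul_of_nonneg_left (sum_le_hasSum _ (fun i _ => hd0 i) hd.hasSum) hMc))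

/-- **NE9 WITH COLUMN-BOUNDED MODULI, END TO END AT NODE U3.**  `NE9 E W κ Λ` with nonnegative moduli of column sums `≤ M_c`, and two
admissible coupling sequences whose discrepancies sit under a summable profile `d`: the scale-`j` term difference is `≤ e^{−κd_j(X)}·b_j`
with the EXPLICIT majorant `b_j = Σ_{i<j} Λ j i·d_i`, `Σ_j b_j ≤ M_c·Σ_i d_i < ∞` — no age profile, no rate. [folklore] -/
theorem ne9_bracket_of_colSum {E : Functional C Bg} {W : Set (ℕ → ℝ)} {κ Mc : ℝ} {Λ : ℕ → ℕ → ℝ} {d : ℕ → ℝ}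
    (h9 : NE9 E W κ Λ) (hΛ : ∀ k i, i ≤ k → 0 ≤ Λ k i) (hcol : ∀ i N, ∑ k ∈ Ico (i + 1) N, Λ k i ≤ Mc)
    {gA gB : ℕ → ℝ} (hgA : gA ∈ W) (hgB : gB ∈ W) (hd : ∀ i, |gA i - gB i| ≤ d i) (hdsum : Summable d) :
    (∀ (U : Bg) (X : C.Dom), |E gA U X - E gB U X|
        ≤ Real.exp (-(κ * C.d X)) * ∑ i ∈ range (C.scale X), Λ (C.scale X) i * d i)
      ∧ Summable (fun j => ∑ i ∈ range j, Λ j i * d i)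
      ∧ ∑' j, ∑ i ∈ range j, Λ j i * d i ≤ Mc * ∑' i, d i := by
  have hd0 : ∀ i, 0 ≤ d i := fun i => (abs_nonneg _).trans (hd i)
  refine ⟨fun U X => ?_, summable_historySum_of_colSum hΛ hcol hd0 hdsum, tsum_historySum_le_of_colSum hΛ hcol hd0 hdsum⟩
  refine (h9 gA hgA gB hgB U X).trans (mul_le_mul_of_nonneg_left ?_ (Real.exp_pos _).le)
  exact sum_le_sum fun i hi => mul_le_mul_of_nonneg_left (hd i) (hΛ _ i (mem_range.mp hi).le)

/-- **COLUMNS ⇒ NODE U6.**  Any injection dominated, uniformly in the cutoff, by the column-bounded bracket majorant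
(`0 ≤ inj K j ≤ Σ_{i<j} Λ j i·d_i`) has `Summable (T4CauchySum.delta E ρ inj)` for every `0 ≤ E`, `0 ≤ ρ < 1` — node U6's socket, through
gen 2's `SummableMemory.summable_delta_of_scaleProfile` BY NAME. [folklore] -/
theorem summable_delta_of_colSum {Λ : ℕ → ℕ → ℝ} {Mc : ℝ} (hΛ : ∀ k i, i ≤ k → 0 ≤ Λ k i)
    (hcol : ∀ i N, ∑ k ∈ Ico (i + 1) N, Λ k i ≤ Mc)
    {d : ℕ → ℝ} (hd0 : ∀ i, 0 ≤ d i) (hd : Summable d) {E ρ : ℝ} (hE : 0 ≤ E) (hρ : 0 ≤ ρ) (hρ1 : ρ < 1)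
    {inj : ℕ → ℕ → ℝ} (hinj : ∀ K j : ℕ, j ≤ K → 0 ≤ inj K j ∧ inj K j ≤ ∑ i ∈ range j, Λ j i * d i) :
    Summable (delta E ρ inj) :=
  summable_delta_of_scaleProfile hE hρ hρ1
    (fun j => sum_nonneg fun i hi => mul_nonneg (hΛ j i (mem_range.mp hi).le) (hd0 i))
    (summable_historySum_of_colSum hΛ hcol hd0 hd) hinj

/-! ## §4 Rows alone do NOT reach node U6: the bare-coupling memory `Λ♭ k i = 𝟙_{i=0}` -/

/-- The bare-coupling memory has every ROW sum equal to `1`. [folklore] -/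
theorem bareMemory_rowSum (k : ℕ) :
    ∑ i ∈ range (k + 1), (fun _ i : ℕ => if i = 0 then (1 : ℝ) else 0) k i = 1 := by
  simp

/-- … is NOT `FadingMemory C₉ ω` for any constant and any `0 ≤ ω < 1` (it would force `1 ≤ C₉ω^k` for all `k`). [folklore] -/
theorem bareMemory_not_fadingMemory {C₉ ω : ℝ} (hω0 : 0 ≤ ω) (hω1 : ω < 1) :
    ¬ FadingMemory C₉ ω (fun _ i : ℕ => if i = 0 then (1 : ℝ) else 0) := by
  intro h
  have ht : Tendsto (fun k : ℕ => C₉ * ω ^ k) atTop (𝓝 0) := by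
    simpa using (tendsto_pow_atTop_nhds_zero_of_lt_one hω0 hω1).const_mul C₉
  obtain ⟨N, hN⟩ := eventually_atTop.mp (ht.eventually (gt_mem_nhds one_pos))
  have h1 : (1 : ℝ) ≤ C₉ * ω ^ N := by simpa using (h N 0 (Nat.zero_le N)).2
  linarith [hN N le_rfl]

/-- … and has column `0` equal to `N − 1` below the cutoff `N`, hence UNBOUNDED columns. [folklore] -/
theorem bareMemory_colSum (N : ℕ) :
    ∑ k ∈ Ico 1 N, (fun _ i : ℕ => if i = 0 then (1 : ℝ) else 0) k 0 = ((N - 1 : ℕ) : ℝ) := by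
  simp

/-- Against the discrepancy `d = 𝟙_{i=0}` the bare-coupling bracket is `1` at every creation step `j ≥ 1`. [folklore] -/
theorem bareMemory_bracket {j : ℕ} (hj : 1 ≤ j) :
    ∑ i ∈ range j, (fun _ i : ℕ => if i = 0 then (1 : ℝ) else 0) j i * (if i = 0 then (1 : ℝ) else 0) = 1 := by
  rw [sum_eq_single 0]
  · simp
  · intro i _ hi
    simp [hi]
  · intro h
    exact absurd (mem_range.mpr hj) h

/-- **ROW-BOUNDED MEMORY DOES NOT REACH NODE U6** (the E-side verdict on «NE9′ = NE9 with `FadingMemory` weakened to K-uniform row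
sums»).  There are nonnegative moduli with ALL ROW SUMS `≤ 1` and a discrepancy profile that is geometrically small AND summable
(`0 ≤ d_i ≤ (½)^i`) whose bracket majorant `j ↦ Σ_{i<j} Λ j i·d_i` does NOT tend to `0` — so lies below no `b·θ^j`, `θ < 1`
(`T4OutputRate.u3_geometric`), and below no summable scale profile (node U6) — and is NOT summable; the same moduli have unbounded
column sums, so §3 does not apply, as it must not.  Row sums serve node U5b (§2) and the β-side row split of (E33); the currency
node U3 → U6 needs on the E-side is the COLUMN sum (§3). [folklore] -/
theorem exists_rowBounded_bracket_not_summable :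
    ∃ Λ : ℕ → ℕ → ℝ, ∃ d : ℕ → ℝ,
      (∀ k i, i ≤ k → 0 ≤ Λ k i) ∧ (∀ k, ∑ i ∈ range (k + 1), Λ k i ≤ 1) ∧
      (∀ i, 0 ≤ d i) ∧ (∀ i, d i ≤ (1 / 2 : ℝ) ^ i) ∧ Summable d ∧
      ¬ Tendsto (fun j => ∑ i ∈ range j, Λ j i * d i) atTop (𝓝 0) ∧
      ¬ Summable (fun j => ∑ i ∈ range j, Λ j i * d i) ∧
      (∀ Mc : ℝ, ∃ N, Mc < ∑ k ∈ Ico 1 N, Λ k 0) := by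
  refine ⟨fun _ i => if i = 0 then (1 : ℝ) else 0, fun i => if i = 0 then (1 : ℝ) else 0,
    fun k i _ => ?_, fun k => (bareMemory_rowSum k).le, fun i => ?_, fun i => ?_, ?_, ?_, ?_, fun Mc => ?_⟩
  · by_cases hi : i = 0 <;> simp [hi]
  · by_cases hi : i = 0 <;> simp [hi]
  · by_cases hi : i = 0
    · subst hi; simp
    · simp only [hi, if_false]; positivity
  · exact summable_of_ne_finset_zero (s := {0}) fun i hi => by
      rw [mem_singleton] at hi
      simp [hi]
  · -- the bracket is eventually the constant 1, which does not tend to 0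
    intro h
    have hev : ∀ᶠ j : ℕ in atTop,
        (∑ i ∈ range j, (fun _ i : ℕ => if i = 0 then (1 : ℝ) else 0) j i * (if i = 0 then (1 : ℝ) else 0)) = 1 :=
      eventually_atTop.mpr ⟨1, fun j hj => bareMemory_bracket hj⟩
    have h1 : Tendsto (fun _ : ℕ => (1 : ℝ)) atTop (𝓝 0) := h.congr' hev
    exact zero_ne_one (tendsto_nhds_unique h1 tendsto_const_nhds)
  · intro h
    have h0 := h.tendsto_atTop_zero
    have hev : ∀ᶠ j : ℕ in atTop,
        (∑ i ∈ range j, (fun _ i : ℕ => if i = 0 then (1 : ℝ) else 0) j i * (if i = 0 then (1 : ℝ) else 0)) = 1 :=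
      eventually_atTop.mpr ⟨1, fun j hj => bareMemory_bracket hj⟩
    have h1 : Tendsto (fun _ : ℕ => (1 : ℝ)) atTop (𝓝 0) := h0.congr' hev
    exact zero_ne_one (tendsto_nhds_unique h1 tendsto_const_nhds)
  · refine ⟨⌈Mc⌉₊ + 2, ?_⟩
    rw [bareMemory_colSum]
    have h1 : Mc ≤ (⌈Mc⌉₊ : ℝ) := Nat.le_ceil Mc
    have h2 : ((⌈Mc⌉₊ + 2 - 1 : ℕ) : ℝ) = (⌈Mc⌉₊ : ℝ) + 1 := by
      rw [show ⌈Mc⌉₊ + 2 - 1 = ⌈Mc⌉₊ + 1 by omega]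
      push_cast
      ring
    rw [h2]
    linarith

end Summit.QuantumFields.BalabanUV.T4Continuum.NE9.SchurMemory
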